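import Literature.NumberTheory.LFunctions.TrivialZerosSimple
import Literature.NumberTheory.LFunctions.WeilZeroSum
import Mathlib.NumberTheory.Harmonic.EulerMascheroni
import HarnessLib

/-!
# RiemannHypothesis / Nyman–Beurling — the DILATE ZERO SUMS, II: the zero sum `P` of the `ψ₁` formula in closed form
# down to `x = 1` (RH-FREE)

Step II of the T7 programme (see `NymanBeurlingDilateZeroSumIntegral.lean`).  From the tree's exact explicit formula
for `ψ₁` (`psiOne_eq_explicit`, `hasSum_psiOneRemainder_re`, `riemannZetaZeroOrder_trivialZero`):
for every real `x ≥ 1`,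

  `P(x) := Σ_ρ m_ρ x^{ρ+1}/(ρ(ρ+1)) = x²/2 − x log 2π − T(x) − ψ₁(x) + (ζ'/ζ)(−1)`,
  `T(x) := Σ_{k≥0} x^{−(2k+1)}/((2k+2)(2k+1))`  (`pSum_eq`),

including the endpoint `x = 1`, where `E(1) = (ζ'/ζ)(−1) − log 2` (`psiOneRemainder_one`) is obtained by continuity
(`P` and `T` are continuous by dominated convergence, `ψ₁ = 0` on `[1,2)`, and `T(1) = Σ 1/((2k+1)(2k+2)) = log 2`,
`hasSum_one_div_odd_mul_even`).
RH-FREE [rh-li-eng-3 g5]: unconditional explicit-formula analysis; nothing here bears on the truth of RH.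
-/

noncomputable section

set_option linter.dupNamespace false

open Complex Filter Set MeasureTheory Topology intervalIntegral
open scoped Real

namespace Summit.RiemannHypothesis.RiemannHypothesis.Theorems.NbTheory

open Literature.NumberTheory.LFunctions

namespace DilateExplicit

/-! ## `Σ_{k≥0} 1/((2k+1)(2k+2)) = log 2` -/

/-- Partial sums of the grouped alternating harmonic series: `Σ_{k<K} 1/((2k+1)(2k+2)) = H_{2K} − H_K`. -/
lemma sum_range_one_div_odd_mul_even (K : ℕ) :
    ∑ k ∈ Finset.range K, 1 / ((2 * (k : ℝ) + 1) * (2 * k + 2)) = (harmonic (2 * K) : ℝ) - harmonic K := by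
  induction K with
  | zero => simp
  | succ K ih =>
    rw [Finset.sum_range_succ, ih, show 2 * (K + 1) = 2 * K + 1 + 1 by ring, harmonic_succ, harmonic_succ,
      harmonic_succ]
    push_cast
    have h1 : (2 * (K : ℝ) + 1) ≠ 0 := by positivity
    have h2 : (2 * (K : ℝ) + 2) ≠ 0 := by positivity
    have h3 : ((K : ℝ) + 1) ≠ 0 := by positivity
    field_simp
    ring

/-- **`Σ_{k≥0} 1/((2k+1)(2k+2)) = log 2`** (`H_{2K} − H_K → log 2` by `H_n − log n → γ`). -/
theorem hasSum_one_div_odd_mul_even :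
    HasSum (fun k : ℕ ↦ 1 / ((2 * (k : ℝ) + 1) * (2 * k + 2))) (Real.log 2) := by
  have hγ := Real.tendsto_harmonic_sub_log
  have h2 : Tendsto (fun K : ℕ ↦ (harmonic (2 * K) : ℝ) - Real.log ((2 * K : ℕ) : ℝ)) atTop
      (𝓝 Real.eulerMascheroniConstant) :=
    hγ.comp (tendsto_id.const_mul_atTop' (by norm_num : 0 < 2))
  have hlim : Tendsto (fun K : ℕ ↦ ∑ k ∈ Finset.range K, 1 / ((2 * (k : ℝ) + 1) * (2 * k + 2))) atTop
      (𝓝 (Real.log 2)) := by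
    have h3 : Tendsto (fun K : ℕ ↦ ((harmonic (2 * K) : ℝ) - Real.log ((2 * K : ℕ) : ℝ)) -
        ((harmonic K : ℝ) - Real.log K) + Real.log 2) atTop
        (𝓝 (Real.eulerMascheroniConstant - Real.eulerMascheroniConstant + Real.log 2)) :=
      (h2.sub hγ).add_const _
    rw [show Real.eulerMascheroniConstant - Real.eulerMascheroniConstant + Real.log 2 = Real.log 2 by ring] at h3
    refine h3.congr' ?_
    filter_upwards [eventually_ge_atTop 1] with K hK
    rw [sum_range_one_div_odd_mul_even]
    have hK0 : (0 : ℝ) < K := by exact_mod_cast hK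
    push_cast
    rw [Real.log_mul two_ne_zero hK0.ne']
    ring
  exact (hasSum_iff_tendsto_nat_of_nonneg (fun k ↦ by positivity) _).2 hlim

/-- Summability of `1/((2k+1)(2k+2))`. -/
lemma summable_one_div_odd_mul_even : Summable fun k : ℕ ↦ 1 / ((2 * (k : ℝ) + 1) * (2 * k + 2)) :=
  hasSum_one_div_odd_mul_even.summable

/-! ## The trivial-zero series `T(x) = Σ_k x^{−(2k+1)}/((2k+2)(2k+1))` on `[1, ∞)` -/

/-- Termwise bound: for `x ≥ 1`, `x^{−(2k+1)}/((2k+2)(2k+1)) ≤ 1/((2k+1)(2k+2))`. -/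
lemma trivTerm_le {x : ℝ} (hx : 1 ≤ x) (k : ℕ) :
    x ^ (-(2 * (k : ℝ) + 1)) / ((2 * k + 2) * (2 * k + 1)) ≤ 1 / ((2 * (k : ℝ) + 1) * (2 * k + 2)) := by
  have h1 : x ^ (-(2 * (k : ℝ) + 1)) ≤ 1 :=
    Real.rpow_le_one_of_one_le_of_nonpos hx (by nlinarith [(k.cast_nonneg : (0 : ℝ) ≤ k)])
  rw [mul_comm (2 * (k : ℝ) + 2)]
  exact div_le_div_of_nonneg_right h1 (by positivity)

/-- `T` converges for `x ≥ 1`. -/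
lemma summable_trivTerm {x : ℝ} (hx : 1 ≤ x) :
    Summable fun k : ℕ ↦ x ^ (-(2 * (k : ℝ) + 1)) / ((2 * k + 2) * (2 * k + 1)) := by
  refine Summable.of_nonneg_of_le (fun k ↦ ?_) (trivTerm_le hx) summable_one_div_odd_mul_even
  have : 0 < x := by linarith
  positivity

/-- **`T` is continuous on `[1, ∞)`** (uniformly dominated by `Σ 1/((2k+1)(2k+2))`). -/
theorem continuousOn_trivSum :
    ContinuousOn (fun x : ℝ ↦ ∑' k : ℕ, x ^ (-(2 * (k : ℝ) + 1)) / ((2 * k + 2) * (2 * k + 1))) (Set.Ici 1) := by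
  refine continuousOn_tsum (fun k ↦ ?_) summable_one_div_odd_mul_even fun k x hx ↦ ?_
  · refine ContinuousOn.div_const (ContinuousOn.rpow_const continuousOn_id fun x hx ↦ ?_) _
    exact Or.inl (by simp only [id]; linarith [hx.out])
  · have hx' : 1 ≤ x := hx
    have h0 : 0 < x := by linarith
    rw [Real.norm_eq_abs, abs_of_nonneg (by positivity)]
    exact trivTerm_le hx' k

/-- **`T(1) = log 2`.** -/
theorem trivSum_one : ∑' k : ℕ, (1 : ℝ) ^ (-(2 * (k : ℝ) + 1)) / ((2 * k + 2) * (2 * k + 1)) = Real.log 2 := by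
  rw [← hasSum_one_div_odd_mul_even.tsum_eq]
  refine tsum_congr fun k ↦ ?_
  rw [Real.one_rpow]
  ring

/-! ## `ψ₁` vanishes on `[1,2)` -/

/-- `ψ₁(x) = 0` for `1 ≤ x < 2` (only `n = 1` is `≤ x`, and `Λ(1) = 0`). -/
theorem psiOne_eq_zero {x : ℝ} (hx1 : 1 ≤ x) (hx2 : x < 2) : psiOne x = 0 := by
  have hfl : ⌊x⌋₊ = 1 := by
    rw [Nat.floor_eq_iff (by linarith)]
    constructor <;> push_cast <;> linarith
  rw [psiOne, hfl]
  simp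

/-! ## `P` is continuous on `[1, 2]` -/

/-- **`P(x) = Σ_ρ m_ρ x^{ρ+1}/(ρ(ρ+1))` is continuous on `[1, 2]`** (dominated by `4·m_ρ/(|ρ||ρ+1|)`). -/
theorem continuousOn_pSum :
    ContinuousOn (fun x : ℝ ↦ ∑' ρ : ZetaZeros.riemannZetaNontrivialZeros,
      (riemannZetaZeroOrder (ρ : ℂ) : ℂ) * ((x : ℂ) ^ ((ρ : ℂ) + 1) / ((ρ : ℂ) * (ρ + 1)))) (Set.Icc 1 2) := by
  have hsw : Summable fun ρ : ZetaZeros.riemannZetaNontrivialZeros ↦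
      4 * ((riemannZetaZeroOrder (ρ : ℂ) : ℝ) / (‖(ρ : ℂ)‖ * ‖(ρ : ℂ) + 1‖)) := by
    have h := summable_norm_psiOne_zeroTerm (le_refl (1 : ℝ))
    refine (h.congr fun ρ ↦ ?_).mul_left 4
    have hm : (0 : ℝ) < riemannZetaZeroOrder (ρ : ℂ) := by
      have h1 : (1 : ℤ) ≤ riemannZetaZeroOrder (ρ : ℂ) := ZetaZeros.riemannZetaNontrivialZeros.one_le_order ρ.2
      have h0 : (0 : ℤ) < riemannZetaZeroOrder (ρ : ℂ) := by omega
      exact_mod_cast h0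
    rw [Complex.ofReal_one, Complex.one_cpow, norm_mul, norm_div, norm_one, norm_mul, Complex.norm_intCast,
      abs_of_pos hm]
    ring
  refine continuousOn_tsum (fun ρ ↦ ?_) hsw fun ρ x hx ↦ ?_
  · have hre : 0 < ((ρ : ℂ) + 1).re := by
      have := ZetaZeros.riemannZetaNontrivialZeros.re_pos ρ.2
      simp; linarith
    exact (continuous_const.mul ((Complex.continuous_ofReal_cpow_const hre).div_const _)).continuousOn
  · have hx0 : 0 < x := by linarith [hx.1]
    have hm : (0 : ℝ) < riemannZetaZeroOrder (ρ : ℂ) := by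
      have h1 : (1 : ℤ) ≤ riemannZetaZeroOrder (ρ : ℂ) := ZetaZeros.riemannZetaNontrivialZeros.one_le_order ρ.2
      have h0 : (0 : ℤ) < riemannZetaZeroOrder (ρ : ℂ) := by omega
      exact_mod_cast h0
    have hre : ((ρ : ℂ) + 1).re ≤ 2 := by
      have := ZetaZeros.riemannZetaNontrivialZeros.re_lt_one ρ.2
      simp; linarith
    have hpow : ‖(x : ℂ) ^ ((ρ : ℂ) + 1)‖ ≤ 4 := by
      rw [Complex.norm_cpow_eq_rpow_re_of_pos hx0]
      calc x ^ ((ρ : ℂ) + 1).re ≤ x ^ (2 : ℝ) := Real.rpow_le_rpow_of_exponent_le hx.1 hre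
        _ = x ^ 2 := by norm_cast
        _ ≤ 2 ^ 2 := by nlinarith [hx.1, hx.2]
        _ = 4 := by norm_num
    have hden : 0 < ‖(ρ : ℂ)‖ * ‖(ρ : ℂ) + 1‖ := by
      refine mul_pos (norm_pos_iff.2 ?_) (norm_pos_iff.2 ?_)
      · intro h0; have := ZetaZeros.riemannZetaNontrivialZeros.re_pos ρ.2; rw [h0] at this; simp at this
      · intro h0
        have := ZetaZeros.riemannZetaNontrivialZeros.re_pos ρ.2
        have h1 : (ρ : ℂ) = -1 := by linear_combination h0
        rw [h1] at this; simp at this; linarith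
    rw [norm_mul, norm_div, norm_mul, Complex.norm_intCast, abs_of_pos hm]
    calc (riemannZetaZeroOrder (ρ : ℂ) : ℝ) * (‖(x : ℂ) ^ ((ρ : ℂ) + 1)‖ / (‖(ρ : ℂ)‖ * ‖(ρ : ℂ) + 1‖))
        = ((riemannZetaZeroOrder (ρ : ℂ) : ℝ) / (‖(ρ : ℂ)‖ * ‖(ρ : ℂ) + 1‖)) * ‖(x : ℂ) ^ ((ρ : ℂ) + 1)‖ := by
          ring
      _ ≤ ((riemannZetaZeroOrder (ρ : ℂ) : ℝ) / (‖(ρ : ℂ)‖ * ‖(ρ : ℂ) + 1‖)) * 4 :=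
          mul_le_mul_of_nonneg_left hpow (div_nonneg hm.le hden.le)
      _ = 4 * ((riemannZetaZeroOrder (ρ : ℂ) : ℝ) / (‖(ρ : ℂ)‖ * ‖(ρ : ℂ) + 1‖)) := by ring

/-! ## `P` and `E` explicitly, down to `x = 1` -/

/-- The `ψ₁` formula solved for `P`: for `x ≥ 1`, `P(x) = x²/2 − x log 2π + E(x) − ψ₁(x)`. -/
theorem pSum_eq_of_one_le {x : ℝ} (hx : 1 ≤ x) :
    (∑' ρ : ZetaZeros.riemannZetaNontrivialZeros,
      (riemannZetaZeroOrder (ρ : ℂ) : ℂ) * ((x : ℂ) ^ ((ρ : ℂ) + 1) / ((ρ : ℂ) * (ρ + 1)))) =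
      (x : ℂ) ^ 2 / 2 - x * Complex.log (2 * π) + psiOneRemainder x - psiOne x := by
  have h : (psiOne x : ℂ) = (x : ℂ) ^ 2 / 2 -
      (∑' ρ : ZetaZeros.riemannZetaNontrivialZeros,
        (riemannZetaZeroOrder (ρ : ℂ) : ℂ) * ((x : ℂ) ^ ((ρ : ℂ) + 1) / ((ρ : ℂ) * (ρ + 1)))) -
        x * Complex.log (2 * π) + psiOneRemainder x := psiOne_eq_explicit hx
  linear_combination h

/-- For `x > 1`: `E(x) = (ζ'/ζ)(−1) − T(x)` (trivial zeros, simple). -/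
theorem psiOneRemainder_eq_of_one_lt {x : ℝ} (hx : 1 < x) :
    psiOneRemainder x = deriv riemannZeta (-1) / riemannZeta (-1) -
      ((∑' k : ℕ, x ^ (-(2 * (k : ℝ) + 1)) / ((2 * k + 2) * (2 * k + 1)) : ℝ) : ℂ) := by
  have hS := (hasSum_psiOneRemainder_re hx).tsum_eq
  have hR := ofReal_re_sub_psiOneRemainder hx
  rw [hS, ← Complex.sub_re, hR]
  ring

/-- `E` near `1⁺` in terms of `P`: for `x ∈ [1,2)`, `E(x) = P(x) − x²/2 + x log 2π`. -/
lemma psiOneRemainder_eq_pSum {x : ℝ} (hx1 : 1 ≤ x) (hx2 : x < 2) :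
    psiOneRemainder x = (∑' ρ : ZetaZeros.riemannZetaNontrivialZeros,
      (riemannZetaZeroOrder (ρ : ℂ) : ℂ) * ((x : ℂ) ^ ((ρ : ℂ) + 1) / ((ρ : ℂ) * (ρ + 1)))) -
      (x : ℂ) ^ 2 / 2 + x * Complex.log (2 * π) := by
  rw [pSum_eq_of_one_le hx1, psiOne_eq_zero hx1 hx2]
  push_cast
  ring

/-- **`E(1) = (ζ'/ζ)(−1) − log 2`** (right-continuity of both closed forms at `x = 1`). -/
theorem psiOneRemainder_one :
    psiOneRemainder 1 = deriv riemannZeta (-1) / riemannZeta (-1) - (Real.log 2 : ℂ) := by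
  -- `f(x) = P(x) − x²/2 + x log 2π` (= `E(x)` on `[1,2)`), continuous on `[1,2]`
  set f : ℝ → ℂ := fun x ↦ (∑' ρ : ZetaZeros.riemannZetaNontrivialZeros,
      (riemannZetaZeroOrder (ρ : ℂ) : ℂ) * ((x : ℂ) ^ ((ρ : ℂ) + 1) / ((ρ : ℂ) * (ρ + 1)))) -
      (x : ℂ) ^ 2 / 2 + x * Complex.log (2 * π) with hf
  -- `g(x) = c₁ − T(x)`, continuous on `[1, ∞)`
  set g : ℝ → ℂ := fun x ↦ deriv riemannZeta (-1) / riemannZeta (-1) -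
      ((∑' k : ℕ, x ^ (-(2 * (k : ℝ) + 1)) / ((2 * k + 2) * (2 * k + 1)) : ℝ) : ℂ) with hg
  have hfc : ContinuousOn f (Set.Icc 1 2) := by
    refine (continuousOn_pSum.sub (by fun_prop)).add (by fun_prop)
  have hgc : ContinuousOn g (Set.Ici 1) := by
    refine continuousOn_const.sub ?_
    exact Complex.continuous_ofReal.comp_continuousOn continuousOn_trivSum
  -- both tend to their values at `1` along `𝓝[>] 1`
  have hle1 : 𝓝[>] (1 : ℝ) ≤ 𝓝[Set.Icc 1 2] 1 := nhdsWithin_le_of_mem (Icc_mem_nhdsGT one_lt_two)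
  have hle2 : 𝓝[>] (1 : ℝ) ≤ 𝓝[Set.Ici 1] 1 := nhdsWithin_mono _ Set.Ioi_subset_Ici_self
  have hf1 : Tendsto f (𝓝[>] 1) (𝓝 (f 1)) :=
    ((hfc 1 ⟨le_rfl, one_le_two⟩).tendsto).mono_left hle1
  have hg1 : Tendsto g (𝓝[>] 1) (𝓝 (g 1)) := ((hgc 1 Set.self_mem_Ici).tendsto).mono_left hle2
  -- and they agree on `(1, 2)`
  have hfg : f =ᶠ[𝓝[>] (1 : ℝ)] g := by
    filter_upwards [Ioo_mem_nhdsGT one_lt_two] with x hx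
    rw [hf, hg]
    simp only
    rw [← psiOneRemainder_eq_pSum hx.1.le hx.2, psiOneRemainder_eq_of_one_lt hx.1]
  have heq : f 1 = g 1 := tendsto_nhds_unique (hf1.congr' hfg) hg1
  have hE1 : psiOneRemainder 1 = f 1 := by
    rw [hf]
    simp only
    exact psiOneRemainder_eq_pSum le_rfl one_lt_two
  rw [hE1, heq, hg]
  simp only [trivSum_one]

/-- **`E(x) = (ζ'/ζ)(−1) − T(x)` for every `x ≥ 1`.** -/
theorem psiOneRemainder_eq {x : ℝ} (hx : 1 ≤ x) :
    psiOneRemainder x = deriv riemannZeta (-1) / riemannZeta (-1) -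
      ((∑' k : ℕ, x ^ (-(2 * (k : ℝ) + 1)) / ((2 * k + 2) * (2 * k + 1)) : ℝ) : ℂ) := by
  rcases hx.eq_or_lt with h | h
  · rw [← h, trivSum_one, psiOneRemainder_one]
  · exact psiOneRemainder_eq_of_one_lt h

/-- **`P` IN CLOSED FORM ON `[1, ∞)` (RH-FREE):**
`Σ_ρ m_ρ x^{ρ+1}/(ρ(ρ+1)) = (x²/2 − x log 2π − T(x) − ψ₁(x)) + (ζ'/ζ)(−1)` for every real `x ≥ 1`. -/
theorem pSum_eq {x : ℝ} (hx : 1 ≤ x) :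
    (∑' ρ : ZetaZeros.riemannZetaNontrivialZeros,
      (riemannZetaZeroOrder (ρ : ℂ) : ℂ) * ((x : ℂ) ^ ((ρ : ℂ) + 1) / ((ρ : ℂ) * (ρ + 1)))) =
      ((x ^ 2 / 2 - x * Real.log (2 * π) -
          (∑' k : ℕ, x ^ (-(2 * (k : ℝ) + 1)) / ((2 * k + 2) * (2 * k + 1))) - psiOne x : ℝ) : ℂ) +
        deriv riemannZeta (-1) / riemannZeta (-1) := by
  rw [pSum_eq_of_one_le hx, psiOneRemainder_eq hx]
  have hlog : Complex.log (2 * π) = ((Real.log (2 * π) : ℝ) : ℂ) := by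
    rw [Complex.ofReal_log (by positivity)]
    push_cast
    rfl
  rw [hlog]
  push_cast
  ring

end DilateExplicit

end Summit.RiemannHypothesis.RiemannHypothesis.Theorems.NbTheory

end
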